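/-
Copyright: b2b-lace packet (numerics seat num5 = engine-B twin #2, gen 12).  Tail assembly (T) of the
term-wise seed certificate SEEDCERT-P (`b2b-lace-num5-g12/SEEDCERT-P.md`) for the lace-expansion seeds
`I_{n+1,0}(x)`: the series form `I_{n+1,L}(x) = Σ_i C(i+n,n) p_{L+i}(x)` for `d ≥ 2n+3`, exact lower
bounds by partial sums, and the x-blind two-sided enclosure from any proven majorant of the even return
probabilities.
-/
import Literature.Barriers.CriticalPhenomena.RigorousRGSmallParameterHeatKernel
import Literature.Probability.FitznerVanDerHofstad2017.SrwIntegralMonotone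
import HarnessLib

/-!
# Series form and term-wise enclosure of the lace-expansion seeds `I_{n+1,0}(x)`

For `d ≥ 2n + 3` the SRW integral `I_{n+1,L}(x) = srwI d (n+1) L x` is the sum of the series
`Σ_i C(i+n, n) p_{L+i}(x)` (`hasSum_choose_mul_srwLaw_srwI`).  The proof is by induction on `n`:
the case `n = 0` is the tree's `tendsto_sum_range_srwI` at order `0` together with `I_{0,j} = p_j`;
the step regroups the double series `Σ_j Σ_k C(k+n,n) p_{L+j+k}(x)` of non-negative terms
(summable because its iterated sums are the `I_{n+1,L+j}(x)`, whose partial sums converge to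
`I_{n+2,L}(x)` by `tendsto_sum_range_srwI`) along the antidiagonals `j + k = s`, where the
hockey-stick identity `Σ_{k≤s} C(k+n,n) = C(s+n+1,n+1)` produces the next coefficient.
Consequently every partial sum is an exact lower bound (`sum_choose_mul_srwLaw_le_srwI`) and,
pairing `i = 2m, 2m+1` and using `p_i(x) ≤ q_m = p_{2m}(0)` for `2m ≤ i`
(`LongRangePhi4.srwLaw_le_srwLaw_two_mul_zero` of `SrwLawPoissonBessel`, reproduced below as a private lemma
so that this file only depends on the heat-kernel module), any sequence `B` with `q_{M+j} ≤ B(M+j)` for which the two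
series `Σ_j C(2(M+j)+n,n) B(M+j)` and `Σ_j C(2(M+j)+1+n,n) B(M+j)` converge gives the two-sided
enclosure `srwI_succ_mem_Icc`.  The block constants `srwLaw_le_blockConst` and the far-tail
closed form `srwLaw_two_mul_zero_le_farTail` of `SrwLawPoissonBessel` are such `B`.  [folklore]

* `hasSum_srwLaw_srwI_one` — order one: `HasSum (i ↦ p_{L+i}(x)) (I_{1,L}(x))`, `d ≥ 3`;
* `hasSum_choose_mul_srwLaw_srwI` — all orders: `HasSum (i ↦ C(i+n,n) p_{L+i}(x)) (I_{n+1,L}(x))`;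
* `sum_choose_mul_srwLaw_le_srwI`, `srwI_succ_eq_sum_add_tsum` — partial sums and tail;
* `srwI_succ_le_sum_add_tail`, `srwI_succ_mem_Icc` — the enclosure.
-/

namespace Literature.Probability.FitznerVanDerHofstad2017

open Filter Topology Finset
open Literature.Barriers.CriticalPhenomena.LongRangePhi4

variable {d : ℕ}

/-- Local copy (private) of `q_{m+1} ≤ q_m`; the public statement is
`LongRangePhi4.srwLaw_two_mul_succ_zero_le` in `SrwLawPoissonBessel`. [folklore] -/
private theorem q_succ_le (hd : 1 ≤ d) (m : ℕ) :
    srwLaw d (2 * (m + 1)) 0 ≤ srwLaw d (2 * m) 0 := by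
  have h2 : 2 * (m + 1) = 2 + 2 * m := by ring
  rw [h2, srwLaw_add hd 2 (2 * m) 0]
  have hs₁ : Summable fun y : (Fin d → ℤ) => srwLaw d 2 y * srwLaw d (2 * m) (0 - y) :=
    summable_srwLaw_mul hd 2 (2 * m) (fun y => 0 - y)
  have hs₂ : Summable fun y : (Fin d → ℤ) => srwLaw d 2 y * srwLaw d (2 * m) 0 :=
    (hasSum_srwLaw hd 2).summable.mul_right _
  calc ∑' y : (Fin d → ℤ), srwLaw d 2 y * srwLaw d (2 * m) (0 - y)
      ≤ ∑' y : (Fin d → ℤ), srwLaw d 2 y * srwLaw d (2 * m) 0 :=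
        Summable.tsum_le_tsum (fun y => mul_le_mul_of_nonneg_left (srwLaw_two_mul_le hd m _)
          (srwLaw_nonneg _ _)) hs₁ hs₂
    _ = srwLaw d (2 * m) 0 := by rw [tsum_mul_right, (hasSum_srwLaw hd 2).tsum_eq, one_mul]

/-- Local copy (private) of `p_i(x) ≤ q_m` for `2m ≤ i`; public statement
`LongRangePhi4.srwLaw_le_srwLaw_two_mul_zero` in `SrwLawPoissonBessel`. [folklore] -/
private theorem p_le_q (hd : 1 ≤ d) {i m : ℕ} (h : 2 * m ≤ i) (x : (Fin d → ℤ)) :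
    srwLaw d i x ≤ srwLaw d (2 * m) 0 := by
  have hanti : Antitone fun m : ℕ => srwLaw d (2 * m) 0 :=
    antitone_nat_of_succ_le fun m => q_succ_le hd m
  exact (srwLaw_le_srwLaw_even_zero hd i x).trans (hanti (by omega : m ≤ i / 2))

/-- Series form of `I_{1,L}(x)`: `Σ_i p_{L+i}(x) = I_{1,L}(x)` for `d ≥ 3`. [folklore] -/
theorem hasSum_srwLaw_srwI_one (hd : 3 ≤ d) (L : ℕ) (x : Fin d → ℤ) :
    HasSum (fun i => srwLaw d (L + i) x) (srwI d 1 L x) := by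
  have h := tendsto_sum_range_srwI (d := d) (n := 0) (by omega) L x
  rw [hasSum_iff_tendsto_nat_of_nonneg (fun i => srwLaw_nonneg _ _)]
  refine Tendsto.congr (fun N => ?_) h
  exact sum_congr rfl fun j _ => srwI_zero_eq_srwLaw _ _

/-- **Series form of the seeds, all orders**: for `d ≥ 2n + 3`,
`Σ_i C(i+n, n) p_{L+i}(x) = I_{n+1,L}(x)`. [folklore] -/
theorem hasSum_choose_mul_srwLaw_srwI : ∀ (n : ℕ), 2 * n + 3 ≤ d → ∀ (L : ℕ) (x : Fin d → ℤ),
    HasSum (fun i => (((i + n).choose n : ℕ) : ℝ) * srwLaw d (L + i) x) (srwI d (n + 1) L x)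
  | 0, hd, L, x => by
    simpa using hasSum_srwLaw_srwI_one (by omega) L x
  | n + 1, hd, L, x => by
    have ih : ∀ j : ℕ, HasSum (fun k => (((k + n).choose n : ℕ) : ℝ) * srwLaw d (L + j + k) x)
        (srwI d (n + 1) (L + j) x) :=
      fun j => hasSum_choose_mul_srwLaw_srwI n (by omega) (L + j) x
    have hnn : ∀ j k : ℕ, 0 ≤ (((k + n).choose n : ℕ) : ℝ) * srwLaw d (L + j + k) x :=
      fun j k => mul_nonneg (Nat.cast_nonneg _) (srwLaw_nonneg _ _)
    -- outer series: `Σ_j I_{n+1,L+j}(x) = I_{n+2,L}(x)`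
    have hout : HasSum (fun j => srwI d (n + 1) (L + j) x) (srwI d (n + 1 + 1) L x) := by
      rw [hasSum_iff_tendsto_nat_of_nonneg (fun j => (ih j).nonneg (hnn j))]
      exact tendsto_sum_range_srwI (d := d) (n := n + 1) (by omega) L x
    -- the double family and its summability
    obtain ⟨b, hb⟩ : ∃ b : ℕ × ℕ → ℝ,
        ∀ p, b p = (((p.2 + n).choose n : ℕ) : ℝ) * srwLaw d (L + p.1 + p.2) x := ⟨_, fun _ => rfl⟩
    have hb0 : 0 ≤ b := fun p => by rw [hb]; exact hnn _ _
    have hrow : ∀ j, HasSum (fun k => b (j, k)) (srwI d (n + 1) (L + j) x) := fun j => by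
      simp only [hb]; exact ih j
    have hbs : Summable b := by
      refine (summable_prod_of_nonneg hb0).2 ⟨fun j => (hrow j).summable, ?_⟩
      have : (fun j => ∑' k, b (j, k)) = fun j => srwI d (n + 1) (L + j) x :=
        funext fun j => (hrow j).tsum_eq
      rw [this]; exact hout.summable
    have hbsum : HasSum b (srwI d (n + 1 + 1) L x) := by
      have h1 : ∑' p, b p = srwI d (n + 1 + 1) L x := by
        rw [hbs.tsum_prod' (fun j => (hrow j).summable), tsum_congr (fun j => (hrow j).tsum_eq)]
        exact hout.tsum_eq
      exact h1 ▸ hbs.hasSum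
    -- regroup along the antidiagonals `j + k = s`
    have hsig : HasSum (b ∘ (Finset.HasAntidiagonal.sigmaAntidiagonalEquivProd (A := ℕ)))
        (srwI d (n + 1 + 1) L x) :=
      (Equiv.hasSum_iff _).2 hbsum
    refine hsig.sigma fun s => ?_
    have hfib : ∑ c : ↥(antidiagonal s),
        (b ∘ (Finset.HasAntidiagonal.sigmaAntidiagonalEquivProd (A := ℕ))) ⟨s, c⟩ =
        (((s + (n + 1)).choose (n + 1) : ℕ) : ℝ) * srwLaw d (L + s) x := by
      have h1 : ∑ c : ↥(antidiagonal s),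
          (b ∘ (Finset.HasAntidiagonal.sigmaAntidiagonalEquivProd (A := ℕ))) ⟨s, c⟩ =
          ∑ p ∈ antidiagonal s, b p := by
        rw [← Finset.sum_coe_sort (antidiagonal s) b]
        rfl
      have h2 : ∑ p ∈ antidiagonal s, b p =
          ∑ p ∈ antidiagonal s, (((p.2 + n).choose n : ℕ) : ℝ) * srwLaw d (L + s) x := by
        refine sum_congr rfl fun p hp => ?_
        rw [mem_antidiagonal] at hp
        rw [hb, show L + p.1 + p.2 = L + s by omega]
      have h3 : ∑ p ∈ antidiagonal s, (((p.2 + n).choose n : ℕ) : ℝ) =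
          (((s + (n + 1)).choose (n + 1) : ℕ) : ℝ) := by
        have h4 : ∑ p ∈ antidiagonal s, (((p.2 + n).choose n : ℕ) : ℝ) =
            ∑ p ∈ antidiagonal s, (((p.1 + n).choose n : ℕ) : ℝ) := by
          rw [← Finset.Nat.sum_antidiagonal_swap]
          rfl
        rw [h4, Finset.Nat.sum_antidiagonal_eq_sum_range_succ (fun i _ => (((i + n).choose n : ℕ) : ℝ)) s]
        rw [show s + (n + 1) = s + n + 1 by omega]
        exact_mod_cast Nat.sum_range_add_choose s n
      rw [h1, h2, ← sum_mul, h3]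
    exact hfib ▸ hasSum_fintype _

/-- Every partial sum `Σ_{i<R} C(i+n,n) p_i(x)` is a lower bound for `I_{n+1,0}(x)` (`d ≥ 2n+3`).
[folklore] -/
theorem sum_choose_mul_srwLaw_le_srwI (n : ℕ) (hd : 2 * n + 3 ≤ d) (R : ℕ) (x : Fin d → ℤ) :
    ∑ i ∈ range R, (((i + n).choose n : ℕ) : ℝ) * srwLaw d i x ≤ srwI d (n + 1) 0 x := by
  have h := hasSum_choose_mul_srwLaw_srwI n hd 0 x
  simp only [zero_add] at h
  exact sum_le_hasSum (range R) (fun i _ => mul_nonneg (Nat.cast_nonneg _) (srwLaw_nonneg _ _)) h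

/-- `I_{n+1,0}(x) = Σ_{i<R} C(i+n,n) p_i(x) + Σ_i C(R+i+n,n) p_{R+i}(x)` (`d ≥ 2n+3`). [folklore] -/
theorem srwI_succ_eq_sum_add_tsum (n : ℕ) (hd : 2 * n + 3 ≤ d) (R : ℕ) (x : Fin d → ℤ) :
    srwI d (n + 1) 0 x = ∑ i ∈ range R, (((i + n).choose n : ℕ) : ℝ) * srwLaw d i x +
      ∑' i, (((R + i + n).choose n : ℕ) : ℝ) * srwLaw d (R + i) x := by
  have h := hasSum_choose_mul_srwLaw_srwI n hd 0 x
  simp only [zero_add] at h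
  rw [← h.tsum_eq, ← h.summable.sum_add_tsum_nat_add R]
  congr 1
  exact tsum_congr fun i => by rw [add_comm i R]

/-- **Tail assembly for `I_{n+1,0}(x)`** (x-blind): for `d ≥ 2n+3`, every `M` and every sequence `B`
with `q_{M+j} = p_{2(M+j)}(0) ≤ B(M+j)` and the two coefficient-weighted series summable,
`I_{n+1,0}(x) ≤ Σ_{i<2M} C(i+n,n) p_i(x) + Σ_j C(2(M+j)+n,n) B(M+j) + Σ_j C(2(M+j)+1+n,n) B(M+j)`.
[folklore] -/
theorem srwI_succ_le_sum_add_tail (n : ℕ) (hd : 2 * n + 3 ≤ d) (x : Fin d → ℤ) (M : ℕ)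
    {B : ℕ → ℝ} (hB : ∀ j, srwLaw d (2 * (M + j)) 0 ≤ B (M + j))
    (hBe : Summable fun j => (((2 * (M + j) + n).choose n : ℕ) : ℝ) * B (M + j))
    (hBo : Summable fun j => (((2 * (M + j) + 1 + n).choose n : ℕ) : ℝ) * B (M + j)) :
    srwI d (n + 1) 0 x ≤ ∑ i ∈ range (2 * M), (((i + n).choose n : ℕ) : ℝ) * srwLaw d i x +
      (∑' j, (((2 * (M + j) + n).choose n : ℕ) : ℝ) * B (M + j) +
        ∑' j, (((2 * (M + j) + 1 + n).choose n : ℕ) : ℝ) * B (M + j)) := by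
  have hd1 : 1 ≤ d := by omega
  -- the shifted series and its even / odd parts
  obtain ⟨f, hf⟩ : ∃ f : ℕ → ℝ,
      ∀ i, f i = (((2 * M + i + n).choose n : ℕ) : ℝ) * srwLaw d (2 * M + i) x := ⟨_, fun _ => rfl⟩
  have hfs : Summable f := by
    have h := (hasSum_choose_mul_srwLaw_srwI n hd 0 x).summable
    simp only [zero_add] at h
    have h2 := (summable_nat_add_iff (f := fun i => (((i + n).choose n : ℕ) : ℝ) * srwLaw d i x)
      (2 * M)).2 h
    refine h2.congr fun i => ?_
    rw [hf, show i + 2 * M = 2 * M + i by omega]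
  have hinj2 : Function.Injective fun k : ℕ => 2 * k := by
    intro a b h; simp only at h; omega
  have he : Summable fun k => f (2 * k) := hfs.comp_injective hinj2
  have hfs1 : Summable fun i => f (1 + i) := (summable_nat_add_iff 1).2 hfs |>.congr
    fun i => by rw [add_comm]
  have ho : Summable fun k => f (2 * k + 1) :=
    (hfs1.comp_injective hinj2).congr fun k => by simp only [Function.comp]; rw [add_comm]
  have h1 : ∑' k, f (2 * k) ≤ ∑' j, (((2 * (M + j) + n).choose n : ℕ) : ℝ) * B (M + j) := by
    refine Summable.tsum_le_tsum (fun k => ?_) he hBe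
    rw [hf, show 2 * M + 2 * k = 2 * (M + k) by ring]
    exact mul_le_mul_of_nonneg_left
      ((p_le_q hd1 (le_refl (2 * (M + k))) x).trans (hB k))
      (Nat.cast_nonneg _)
  have h2 : ∑' k, f (2 * k + 1) ≤
      ∑' j, (((2 * (M + j) + 1 + n).choose n : ℕ) : ℝ) * B (M + j) := by
    refine Summable.tsum_le_tsum (fun k => ?_) ho hBo
    rw [hf, show 2 * M + (2 * k + 1) = 2 * (M + k) + 1 by ring]
    exact mul_le_mul_of_nonneg_left
      ((p_le_q hd1 (show 2 * (M + k) ≤ 2 * (M + k) + 1 by omega) x).trans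
        (hB k)) (Nat.cast_nonneg _)
  have hsplit : ∑' i, f i = ∑' k, f (2 * k) + ∑' k, f (2 * k + 1) :=
    (tsum_even_add_odd he ho).symm
  have htail : ∑' i, (((2 * M + i + n).choose n : ℕ) : ℝ) * srwLaw d (2 * M + i) x = ∑' i, f i :=
    tsum_congr fun i => (hf i).symm
  rw [srwI_succ_eq_sum_add_tsum n hd (2 * M) x, htail, hsplit]
  linarith

/-- **Two-sided enclosure of `I_{n+1,0}(x)`** (`d ≥ 2n+3`) by an exact partial sum and an x-blind
tail majorant:
`I_{n+1,0}(x) ∈ [S, S + Σ_j C(2(M+j)+n,n) B(M+j) + Σ_j C(2(M+j)+1+n,n) B(M+j)]`,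
`S = Σ_{i<2M} C(i+n,n) p_i(x)`. [folklore] -/
theorem srwI_succ_mem_Icc (n : ℕ) (hd : 2 * n + 3 ≤ d) (x : Fin d → ℤ) (M : ℕ)
    {B : ℕ → ℝ} (hB : ∀ j, srwLaw d (2 * (M + j)) 0 ≤ B (M + j))
    (hBe : Summable fun j => (((2 * (M + j) + n).choose n : ℕ) : ℝ) * B (M + j))
    (hBo : Summable fun j => (((2 * (M + j) + 1 + n).choose n : ℕ) : ℝ) * B (M + j)) :
    srwI d (n + 1) 0 x ∈ Set.Icc (∑ i ∈ range (2 * M), (((i + n).choose n : ℕ) : ℝ) * srwLaw d i x)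
      (∑ i ∈ range (2 * M), (((i + n).choose n : ℕ) : ℝ) * srwLaw d i x +
        (∑' j, (((2 * (M + j) + n).choose n : ℕ) : ℝ) * B (M + j) +
          ∑' j, (((2 * (M + j) + 1 + n).choose n : ℕ) : ℝ) * B (M + j))) :=
  ⟨sum_choose_mul_srwLaw_le_srwI n hd (2 * M) x, srwI_succ_le_sum_add_tail n hd x M hB hBe hBo⟩

end Literature.Probability.FitznerVanDerHofstad2017
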